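import Summits.QuantumFields.YangMills.Theorems.BalabanUVNodesK1AxV11Defs
import Literature.MathematicalPhysics.QuantumFieldTheory.Balaban1983to89.B15Claim189PinsOfHistoryChi  -- v11.3∕v11.4: print's memory `B15Claim189PinsOfHistory.N0OfRecord₁₃Ax` ([IV] p.177 (ii), p.179, p.200)

/-!
# K1ᴬ v11.4 — THE TREE MIRROR OF THE RE-REGISTERED RUNG-1ⱽᵂ TEXT WITH THE RUN-KEYED MEMORY GUARD (★★★ director-ym №682 ∕ №685: the v11.3 step-keyed guard was HOLLOW at the prover's option —
# ref-P g18 KERNEL NOTE 3 `HollowPinProbe`, ref-Q g17 `refQ-g17-E8HollowCross`, ◆ CRIT-1 J31 probe pair; v11.4 CANDIDATE A (R-a″) `N0OfRecord₁₃Ax θ.toStage13Params P P.K ≤ P.K`; ✦ plan g104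
# install ∕ registration `pub-ymgap-plan/D104-K1V114/K1Skeleton13SepCoPHAxV11_4.lean` 33e8cfceee350f1c · 824 l., registered 2026-08-31T23:31:49Z): the ONE definition whose body changed —
# `NodesAtSomeRecord13PWSVW` — KIT-VERBATIM, in its own namespace `…Theorems.K1AxV114Defs` (✓`…K1AxV11Defs` ∕ ✓`…K1AxV114Defs` keep the earlier texts AS HISTORY; every other definition BY NAME
# from ✓`…K1AxV11Defs`), with its kernel doors, and the two stub texts that name it

R134 seat `pub-ymgap-dag-n24-c` g27 (the -a hand on LINE 2′; ★★★ №682 (2)(e′) ∕ №685 «one more edition each of E1 (`K1AxV114Defs` mirror) ∕ E3 ∕ E4 ∕ E6 ∕ E7-U ∕ E8 re-keyed to the registered letter,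
INTENT-first»; this file is the by-name FOUNDATION of those editions — the v11.4 twin of this seat's ✓p835986 `…K1AxV114Defs`), `--kind definition --supports stmt-QuantumFields-27239 --as helper`
(count-neutral; nothing registered here — the plan seat registered the kit by ONE `ledger skeleton check`; on any later re-cut this mirror is superseded, not edited).  Precedent: this lineage's v11.1
mirror ✓p812635 (`…K1AxV11Defs`), v11.2 mirror ✓p822242 (`…K1AxV11LettersDefs`), v11.3 mirror ✓p835986 (`…K1AxV114Defs`); dag-n16-e's `K3AxV8Defs` (dag-lead WORDS 645).

WHAT IS HERE (the installed kit's lines :538–:547 and :566–:569 VERBATIM — namespace `…Theses.BalabanUVNodes.K1Skeleton13SepCoPHAxV11` ↦ `…Theorems.K1AxV114Defs`; `RecordSV`, `Nodes`,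
`NodesAtSomeRecord13PWSV`, `NodesAtSomeRecord13PWS` are ✓`K1AxV11Defs`' ∕ `DagBinding`'s BY NAME, byte-identical to the kit's own):
* `NodesAtSomeRecord13PWSVW` — rung 1ⱽᵂ of LINE 2′, v11.4: the [IV]-pin clause carries print's memory guard KEYED TO THE RUN, `B15Claim189PinsOfHistory.N0OfRecord₁₃Ax θ.toStage13Params P P.K ≤ P.K →`
  (no `lam`: re-selecting `kSel` can no longer vacate the pin — ◆ J31's probe pair decides it; at N12's step row `kSel P = P.K − 1` it IS G4 ✓p835673's step-keyed antecedent
  `N0OfRecord₁₃Ax θL P (λW.kSel P + 1) ≤ λW.kSel P + 1`); every other conjunct byte-identical to v11.2 ∕ v11.3.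
* `nodesAtSomeRecord13PWSVW_of_V` (kit door :567, LINE 2 ⟹ LINE 2′: nodes outside the window AND the memory guard dropped), `nodesAtSomeRecord13PWSVW_of_line1` (LINE 1 ⟹ LINE 2′), and the
  HISTORY DOOR `nodesAtSomeRecord13PWSVW_of_v112` (✓`K1AxV11Defs.NodesAtSomeRecord13PWSVW F →` the run-keyed text: the v11.2 rung is STRONGER, so every v11.2 producer of record feeds v11.4
  through it unchanged; the v11.3 text gets NO door — its guard is keyed to `lam.kSel`, which the v11.4 text does not constrain).
* (namespace `…Theorems.K1AxV114StubTexts`) the two stub TEXTS that name the re-registered rung — `Stub1TextVW := ∀ F, Inhabited13 F → NodesAtSomeRecord13PWSVW F` (kit :593) and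
  `Stub2TextVW := ∀ F, NodesAtSomeRecord13PWSVW F → RunRowsAtSomeRecord13PWSVW F` (kit :601), with the two history doors (`stub1TextVW_of_v112`, `stub2TextVW_to_v112`); locators in prose, not
  `[cite:]` tags (a tagged parameterless `def … : Prop` under Theorems∕ is relocated by the gate); the by-name concluders over these texts read the route decl and live in the sequel
  `…K1AxV114StubTexts` file, which imports the route file directly.
The rung-2 texts `RunRowsAtSomeRecord13PWSVW` ∕ `RunRowsContAtSomeRecord13PWSVW`, `Stub3TextVW` ∕ `Stub3LTextVW`, `RecordSV`, `Inhabited13`, both END roads and all compositions are UNCHANGED at v11.4 and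
stay ✓`K1AxV11Defs`' ∕ ✓`K1AxV11Roads`' ∕ ✓`K1AxV11StubTexts`' ∕ ✓`K1AxV11LettersDefs`'; the six stub NAMES and SIGNATURE STRINGS are byte-kept by the kit (`stub_nodes13PWSVW : ∀ F, Inhabited13 F →
NodesAtSomeRecord13PWSVW F` names THIS def at v11.4).

HONEST COST (★★★ №663 (1) ∕ №682, verbatim, carried by the kit's header and by every edition over this file): «N12 ([IV] basic step) is pinned at every windowed run WHOSE MEMORY FITS; at shorter runs the
`rBasicStep` leaf of `Nodes` is unpinned because print applies no 𝐑 there» — a GAP-STATED corner, named and sourced ([IV] = [Balaban1989LargeFieldI] p.177 (ii), p.179 «We assume that N > N₀»,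
p.198 (1.94), p.200; desk ME #57 LOCATED-NEGATIVE on any short-run (1.89) ∕ first-steps convention); at v11.4 «memory fits» is a property of THE RUN, `N₀(θ,P,P.K) ≤ P.K`.

HONEST FRAMING.  One definition mirrored from the installed kit + two stub texts + five kernel doors (∃-repacking); no estimate; nothing of Bałaban asserted or instantiated; no stub of K1ᴬ proved or
claimed; K1ᴬ OPEN (0∕6 on v11.4 33e8cfceee350f1c); counts UNMOVED (discharged 8∕27, A 8∕28 · K 1∕4).  One finite 𝕋⁴ programme at fixed `ε` — NOT continuum ∕ ℝ⁴ ∕ OS ∕ mass gap ∕ Clay.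
No `sorry`, `instance`, `notation`; standard axioms.
-/

set_option autoImplicit false

noncomputable section

namespace Summit.QuantumFields.YangMills.Theorems.K1AxV114Defs

open Literature.MathematicalPhysics.QuantumFieldTheory.Balaban1983to89
open Literature.MathematicalPhysics.QuantumFieldTheory.Balaban1983to89.T4Continuum
open Literature.MathematicalPhysics.QuantumFieldTheory.Balaban1983to89.DagBinding
open Summit.QuantumFields.YangMills.Theorems.K1AxV11Defs (RecordSV NodesAtSomeRecord13PWS NodesAtSomeRecord13PWSV nodesAtSomeRecord13PWSV_of_line1)

/-- rung 1ⱽᵂ (LINE 2′) = rung 1ⱽ with the thirteen nodes AND the [IV]-pin asked only on runs inside the world's coupling window `(leavesP w P).smallCouplings`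
(dag-n24-c g11 LOCATED-RUNG1-PIN option (α)) AND — v11.4 (R-a″) — only on runs whose memory fits THE RUN, `N₀(θ, P, P.K) ≤ P.K` (dag-n12-d g39 LOCATED-g39-2; print [IV] p.177 (ii), p.179 «N > N₀»: at shorter runs no 𝐑 is applied and no basic step is asked; v11.3's step-keyed guard `N₀(θ, P, kSel P + 1) ≤ kSel P + 1` admitted the re-selection `kSel := 0` and then read nothing — ref-P g18 `HollowPinProbe` de3401d91e459ef9 ∕ ref-Q g17 KERNEL NOTE 3; under N12's step row `kSel P = P.K − 1` the two guards coincide, so dag-n12-d g39's G4 bill ✓p835673 supplies the pin at the selected last step unchanged); every other conjunct byte-identical to `NodesAtSomeRecord13PWSV`.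
[cite: Balaban1989LargeFieldII, Thm 1 p.355 + (0.1) pp.355–356; Balaban1989LargeFieldI, (1.2) p.178, Prop. 1 p.194 (statement shapes; bookkeeping)] -/
def NodesAtSomeRecord13PWSVW (F : T4Family) : Prop :=
  ∃ (θ : Node00.Stage13HParams F 2) (h : θ.Provisos₁₃SepCoPHAx F 2) (v : Node00.Revision₁₃Ax F 2 θ h) (w : WorldP), (θ.ZhUnity F 2 ∧ θ.SlotsNondegenerate₁₃Ax F 2) ∧ θ.Admissible F 2 ∧
    RecordSV F θ h v w ∧ (∀ P : B12.RunParams, (leavesP w P).smallCouplings → Nodes (leavesP w P)) ∧ Node00.PrintedUV3V 2 θ.L ∧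
    ∃ lam : Node00.ResidW F 2, (∀ P : B12.RunParams, 1 ≤ P.K → lam.kSel P < P.K) ∧
      ∀ P : B12.RunParams, lam.kSel P < P.K → (leavesP w P).smallCouplings →
        B15Claim189PinsOfHistory.N0OfRecord₁₃Ax θ.toStage13Params P P.K ≤ P.K →  -- v11.4 (R-a″): print's memory fits inside the RUN — keyed to the run length `P.K`, not to the selected step (v11.3's `N₀(θ,P,kSel P+1) ≤ kSel P+1` was HOLLOW at `kSel := 0`: ref-P g18 ∕ ref-Q g17 KERNEL NOTE 3) ([IV] p.179 «N > N₀»)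
          ((leavesP w P).rBasicStep ↔ B15Leaf (Node00.WOfRecord₁₃Ax F 2 θ.toStage13Params lam P))

/-- LINE 2 ⟹ LINE 2′ at rung 1 (kernel: drop the nodes ∕ the pin outside the window): every LINE-2 (hence every LINE-1) rung-1 result feeds LINE 2′. -/
theorem nodesAtSomeRecord13PWSVW_of_V {F : T4Family} (hN : NodesAtSomeRecord13PWSV F) : NodesAtSomeRecord13PWSVW F := by
  obtain ⟨θ, h, v, w, hU, hθ, hR, hnodes, h08, lam, hsel, hstep⟩ := hN
  exact ⟨θ, h, v, w, hU, hθ, hR, fun P _ => hnodes P, h08, lam, hsel, fun P hk _ _ => hstep P hk⟩  -- v11.3: the memory guard is dropped too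

/-- LINE 1 ⟹ LINE 2′ (v11.4) at rung 1 (the `refl` door of ✓`K1AxV11Defs`, then the window∕memory door). -/
theorem nodesAtSomeRecord13PWSVW_of_line1 {F : T4Family} (hN : NodesAtSomeRecord13PWS F) : NodesAtSomeRecord13PWSVW F :=
  nodesAtSomeRecord13PWSVW_of_V (nodesAtSomeRecord13PWSV_of_line1 hN)

/-- **THE HISTORY DOOR v11.2 ⟹ v11.4** at rung 1ⱽᵂ (kernel: the memory guard is dropped): the v11.2 text ✓`K1AxV11Defs.NodesAtSomeRecord13PWSVW` (unguarded pin, kept AS HISTORY per №663 (2)) is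
STRONGER, so every v11.2 producer of record feeds the v11.4 rung through this door. -/
theorem nodesAtSomeRecord13PWSVW_of_v112 {F : T4Family} (hN : K1AxV11Defs.NodesAtSomeRecord13PWSVW F) : NodesAtSomeRecord13PWSVW F := by
  obtain ⟨θ, h, v, w, hU, hθ, hR, hnodes, h08, lam, hsel, hstep⟩ := hN
  exact ⟨θ, h, v, w, hU, hθ, hR, hnodes, h08, lam, hsel, fun P hk hsc _ => hstep P hk hsc⟩

end Summit.QuantumFields.YangMills.Theorems.K1AxV114Defs

/-! ## The two LINE-2′ stub texts that name the re-registered rung (v11.4 readings of `stub_nodes13PWSVW` ∕ `stub_runRows13PWSVW`; `Stub3TextVW` ∕ `Stub3LTextVW` are UNCHANGED and stay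
✓`K1AxV11StubTexts`' ∕ ✓`K1AxV11LettersDefs`'; the by-name concluders over these texts read the route decl and live in the sequel `…K1AxV114StubTexts`, which imports the route file directly) -/

namespace Summit.QuantumFields.YangMills.Theorems.K1AxV114StubTexts

open Literature.MathematicalPhysics.QuantumFieldTheory.Balaban1983to89.T4Continuum
open Summit.QuantumFields.YangMills.Theorems.K1AxV11Defs (Inhabited13 RunRowsAtSomeRecord13PWSVW)
open Summit.QuantumFields.YangMills.Theorems.K1AxV114Defs (NodesAtSomeRecord13PWSVW nodesAtSomeRecord13PWSVW_of_v112)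

/-- **STUB 1ⱽᵂ's TEXT, v11.4** (kit :593 `stub_nodes13PWSVW`, XL): the thirteen DAG nodes at SOME revised Stage-13 record, window-guarded, N08 pinned by name, N12 pinned by name ON THE WINDOWED
RUNS WHOSE MEMORY FITS (run-keyed, v11.4). (Balaban1989LargeFieldII, Thm 1 p.355, (0.1) pp.355–356; Balaban1988Convergent, Cor. 3 (2.50) p.264; Balaban1989LargeFieldI p.177 (ii), p.179 (statement shapes); bookkeeping) -/
def Stub1TextVW : Prop := ∀ F : T4Family, Inhabited13 F → NodesAtSomeRecord13PWSVW F

/-- **STUB 2ⱽᵂ's TEXT, v11.4** (kit :601 `stub_runRows13PWSVW`, L): the run rows (i)–(iv) of `β_θ` at some rung witness, FROM the v11.4 rung-1ⱽᵂ text (the rung-2 text itself is unchanged).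
(Balaban1987RG1, Thm 3 p.264, (1.20)–(1.22) p.264, (5.10) p.293 (statement shapes); bookkeeping) -/
def Stub2TextVW : Prop := ∀ F : T4Family, NodesAtSomeRecord13PWSVW F → RunRowsAtSomeRecord13PWSVW F

/-- THE HISTORY DOOR at stub 1ⱽᵂ (texts unfolded; ✓`K1AxV11StubTexts.Stub1TextVW` lives in the Theses-cone file, so it is spelled here): a v11.2 stub-1ⱽᵂ proof (unguarded pin) IS a v11.4 one. -/
theorem stub1TextVW_of_v112 (h₁ : ∀ F : T4Family, Inhabited13 F → K1AxV11Defs.NodesAtSomeRecord13PWSVW F) : Stub1TextVW := fun F hF => nodesAtSomeRecord13PWSVW_of_v112 (h₁ F hF)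

/-- Conversely at stub 2ⱽᵂ: a v11.4 stub-2ⱽᵂ proof serves the v11.2 text (its hypothesis is weaker). -/
theorem stub2TextVW_to_v112 (h₂ : Stub2TextVW) : ∀ F : T4Family, K1AxV11Defs.NodesAtSomeRecord13PWSVW F → RunRowsAtSomeRecord13PWSVW F := fun F hN => h₂ F (nodesAtSomeRecord13PWSVW_of_v112 hN)

end Summit.QuantumFields.YangMills.Theorems.K1AxV114StubTexts

end
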